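import Summits.QuantumFields.BalabanUV.T4Continuum.Spine.NE9.DirectPairingApex

/-!
# T⁴ programme, spine estimate NE9 — KING'S PER-STRING SOCKET IS EQUIVALENT TO THE EXISTENCE TARGET: the converse
# `HasContinuumLimit ⇒ King's socket` by equi-Lipschitz generating functions (Arzelà–Ascoli on the `l₀`-ball) — census item C38b of cell
# `pub-balaban-gaps`, seat ne9 (gen 10)

Cell `pub-balaban-gaps` (YM blitz G2, seat ne9, unit `pub-balaban-gaps-ne9-g10`; record `run/shared/lean/pub/pub-balaban-gaps/ne/NE9.md`
§5 row C38b).  Summits-side bookkeeping; elementary real analysis over the tree's node-U6∕U0 vocabulary (`T4CauchySum.genFun`, `genFunLim`;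
`T4GenFunBounds.schemeZ`, `abs_genFun_schemeZ_le`, `abs_genFun_schemeZ_sub_le`; `T4GenFunConverse.tendsto_genFunLim_of_hasContinuumLimit`;
`Missing.HasContinuumLimit`).  NO definition (King's socket is written INLINE); nothing of Bałaban's is asserted.

WHY.  `DirectPairingApex` (census C38, this seat) showed that King's PER-STRING socket — per string an `l₀ > 0`, a `vol`, an offset `K₀` and
remainders `Δ_K → 0` with `|log Z_{K₀+K+n}(t) − log Z_{K₀+K}(t) − c| ≤ vol·Δ_K` on `|t| ≤ l₀` — feeds the apex (`StringwiseGenFunCauchy` ⇒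
`HasContinuumLimit` ⇒ `ContinuumYM4Torus`) and is implied by node U5's consecutive output.  This file closes the circle: the existence target
ITSELF implies King's socket, so the socket is EXACTLY as strong as `Missing.HasContinuumLimit S` (and as `T4ApexHybrid.StringwiseGenFunCauchy S`)
— re-wiring the spine's NE9 slot through King's currency asks NOTHING beyond the target.
* §1 `tendstoUniformly_of_equiLipschitz` [folklore]: on a compact set, an equi-Lipschitz sequence of real functions converging pointwise converges
  UNIFORMLY (finite `δ`-net; the limit inherits the Lipschitz bound); `exists_unifRemainder`: hence, with a uniform bound `B`, there are remainders
  `Δ_K → 0` with `|G_{K+n}(t) − G_K(t)| ≤ Δ_K` for ALL `n` and all `t` in the set (`Δ_K` = the supremum of the direct differences from level `K` on).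
* §2 `king_of_hasContinuumLimit`: for a scheme with `β_K ≥ 0` and measurable observables bounded by `1`, the generating functions
  `G_K = genFun (schemeZ S os) K` are 1-Lipschitz (`abs_genFun_schemeZ_sub_le`), bounded by `|t|` (`abs_genFun_schemeZ_le`) and converge pointwise
  under `HasContinuumLimit S` (`tendsto_genFunLim_of_hasContinuumLimit`) — so §1 gives King's socket with `l₀ = vol = 1`, `K₀ = 0` and the constants
  `c_{K,n} = log Z_{K+n}(0) − log Z_K(0)`.
* §3 THE EQUIVALENCES, with `DirectPairingApex` (p362409) imported: `king_iff_hasContinuumLimit`, `king_iff_stringwiseGenFunCauchy` (scheme level)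
  and, under the targets' quantifier prefix, `kingUnder_iff_stringwiseUnder`, `kingUnder_iff_limit_exists` — KING'S SOCKET UNDER THE PREFIX IS THE
  EXISTENCE TARGET `ym4_torus_continuum_limit_exists` (for data with measurable averaging maps; via `T4ApexHybrid.limit_exists_iff_stringwiseUnder`).

VERDICT FOR THE ROW (census C38b): King's per-string socket ⟺ `HasContinuumLimit S` ⟺ `StringwiseGenFunCauchy S` (with the tree's
`T4ApexHybrid.stringwise_iff_hasContinuumLimit`); under the targets' prefix King's socket ⟺ the existence target.  CLASSIFICATION OF NE9 UNCHANGED: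
WORK-bound (W1); instance 0∕1.

HONEST FRAMING: bookkeeping for rung (B)+1 on ONE FIXED finite four-torus; real analysis on hypothesis SHAPES; `HasContinuumLimit` is the OPEN
existence target, assumed here only as the antecedent of an implication; NE9 NOT PRINTED ∕ NOT PROVED; spine PROVED 0∕9 unchanged; NOT UV
stability, NOT the continuum limit, NOT infinite volume, NOT a mass gap, NOT Clay.  HONEST DEPENDENCY: continuum YM on T⁴ ⇐ BetaPertH ∧ nine spine
estimates (0∕9 proved); BetaPertH ⇐ (D1) ∧ (D4) ∧ CAP+tail.

References (TYPES only): [King1986] = C. King, Commun. Math. Phys. **102** (1986) 649–677, Thm 3.4 (3.9) p. 656, p. 657.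
-/

namespace Summit.QuantumFields.BalabanUV.T4Continuum.NE9.DirectPairingApexConverse

open scoped BigOperators
open Filter Topology Metric Set
open Literature.MathematicalPhysics.QuantumFieldTheory.Balaban1983to89
open T4CauchySum (genFun genFunLim)
open Missing (TorusScheme HasContinuumLimit)
open T4Continuum
open Summit.QuantumFields.BalabanUV.T4Continuum.NE9.DirectPairingApex
  (stringwiseGenFunCauchy_of_king hasContinuumLimit_of_king stringwiseUnder_of_kingUnder)

/-! ## §1 Equi-Lipschitz + pointwise convergence on a compact set ⇒ uniform convergence ⇒ n-uniform direct remainders -/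

/-- **EQUI-LIPSCHITZ + POINTWISE ⇒ UNIFORM** on a compact set of reals (Arzelà–Ascoli, the easy half): a finite `δ`-net, the Lipschitz bound
for the members and — by passage to the limit — for the limit function. [folklore] -/
theorem tendstoUniformly_of_equiLipschitz {G : ℕ → ℝ → ℝ} {g : ℝ → ℝ} {S : Set ℝ} (hS : IsCompact S) {L : ℝ} (hL : 0 < L)
    (hlip : ∀ K, ∀ s ∈ S, ∀ t ∈ S, |G K t - G K s| ≤ L * |t - s|)
    (hpt : ∀ t ∈ S, Tendsto (fun K => G K t) atTop (𝓝 (g t))) :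
    ∀ ε : ℝ, 0 < ε → ∀ᶠ K in atTop, ∀ t ∈ S, |G K t - g t| ≤ ε := by
  intro ε hε
  have hδpos : 0 < ε / 3 / L := by positivity
  -- the limit inherits the Lipschitz bound
  have hg : ∀ s ∈ S, ∀ t ∈ S, |g t - g s| ≤ L * |t - s| := fun s hs t ht =>
    le_of_tendsto (((hpt t ht).sub (hpt s hs)).abs) (Eventually.of_forall fun K => hlip K s hs t ht)
  obtain ⟨net, hnetS, hfin, hcover⟩ := finite_cover_balls_of_compact hS hδpos
  have hcent : ∀ᶠ K in atTop, ∀ c ∈ net, |G K c - g c| < ε / 3 :=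
    hfin.eventually_all.2 fun c hc => by
      have h2 : Tendsto (fun K => |G K c - g c|) atTop (𝓝 0) := by
        have h := ((hpt c (hnetS hc)).sub_const (g c)).abs
        rwa [sub_self, abs_zero] at h
      exact h2.eventually (gt_mem_nhds (by positivity))
  filter_upwards [hcent] with K hK t ht
  obtain ⟨c, hc, htc⟩ := Set.mem_iUnion₂.1 (hcover ht)
  have htc' : |t - c| < ε / 3 / L := by
    have h := mem_ball.1 htc
    rwa [Real.dist_eq] at h
  have hLδ : L * (ε / 3 / L) = ε / 3 := by field_simp
  have h1 : |G K t - G K c| ≤ ε / 3 := by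
    calc |G K t - G K c| ≤ L * |t - c| := hlip K c (hnetS hc) t ht
      _ ≤ L * (ε / 3 / L) := mul_le_mul_of_nonneg_left htc'.le hL.le
      _ = ε / 3 := hLδ
  have h3 : |g c - g t| ≤ ε / 3 := by
    calc |g c - g t| ≤ L * |c - t| := hg t ht c (hnetS hc)
      _ ≤ L * (ε / 3 / L) := mul_le_mul_of_nonneg_left (by rw [abs_sub_comm]; exact htc'.le) hL.le
      _ = ε / 3 := hLδ
  calc |G K t - g t| = |(G K t - G K c) + (G K c - g c) + (g c - g t)| := by ring_nf
    _ ≤ |G K t - G K c| + |G K c - g c| + |g c - g t| := abs_add_three _ _ _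
    _ ≤ ε / 3 + ε / 3 + ε / 3 := add_le_add (add_le_add h1 (hK c hc).le) h3
    _ = ε := by ring

/-- **n-UNIFORM DIRECT REMAINDERS**: under the hypotheses of `tendstoUniformly_of_equiLipschitz` on the interval `[−l₀, l₀]` plus a uniform bound
`|G_K(t)| ≤ B`, there are remainders `Δ_K → 0` with `|G_{K+n}(t) − G_K(t)| ≤ Δ_K` for ALL `n` and all `|t| ≤ l₀` — `Δ_K` is the supremum of the
direct differences from level `K` on (bounded by `2B`; eventually `≤ 2ε∕3` by uniform convergence). [folklore] -/
theorem exists_unifRemainder {G : ℕ → ℝ → ℝ} {g : ℝ → ℝ} {l₀ L B : ℝ} (hl₀ : 0 ≤ l₀) (hL : 0 < L)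
    (hlip : ∀ K, ∀ s ∈ Icc (-l₀) l₀, ∀ t ∈ Icc (-l₀) l₀, |G K t - G K s| ≤ L * |t - s|)
    (hB : ∀ K, ∀ t ∈ Icc (-l₀) l₀, |G K t| ≤ B)
    (hpt : ∀ t ∈ Icc (-l₀) l₀, Tendsto (fun K => G K t) atTop (𝓝 (g t))) :
    ∃ Δ : ℕ → ℝ, Tendsto Δ atTop (𝓝 0) ∧ ∀ K n : ℕ, ∀ t ∈ Icc (-l₀) l₀, |G (K + n) t - G K t| ≤ Δ K := by
  let D : ℕ → Set ℝ := fun K => {x | ∃ n : ℕ, ∃ t ∈ Icc (-l₀) l₀, x = |G (K + n) t - G K t|}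
  have h0mem : (0 : ℝ) ∈ Icc (-l₀) l₀ := ⟨by linarith, hl₀⟩
  have hne : ∀ K, (D K).Nonempty := fun K => ⟨_, 0, 0, h0mem, rfl⟩
  have hbdd : ∀ K, BddAbove (D K) := fun K => by
    refine ⟨B + B, ?_⟩
    rintro x ⟨n, t, ht, rfl⟩
    calc |G (K + n) t - G K t| ≤ |G (K + n) t| + |G K t| := abs_sub _ _
      _ ≤ B + B := add_le_add (hB _ t ht) (hB _ t ht)
  refine ⟨fun K => sSup (D K), ?_, fun K n t ht => le_csSup (hbdd K) ⟨n, t, ht, rfl⟩⟩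
  rw [Metric.tendsto_atTop]
  intro ε hε
  obtain ⟨K₀, hK₀⟩ := eventually_atTop.1
    (tendstoUniformly_of_equiLipschitz isCompact_Icc hL hlip hpt (ε / 3) (by positivity))
  refine ⟨K₀, fun K hK => ?_⟩
  have hle : sSup (D K) ≤ ε / 3 + ε / 3 := csSup_le (hne K) (by
    rintro x ⟨n, t, ht, rfl⟩
    have a := hK₀ (K + n) (le_trans hK (Nat.le_add_right K n)) t ht
    have b := hK₀ K hK t ht
    calc |G (K + n) t - G K t| = |(G (K + n) t - g t) - (G K t - g t)| := by ring_nf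
      _ ≤ |G (K + n) t - g t| + |G K t - g t| := abs_sub _ _
      _ ≤ ε / 3 + ε / 3 := add_le_add a b)
  have hge : 0 ≤ sSup (D K) := le_csSup_of_le (hbdd K) ⟨0, 0, h0mem, rfl⟩ (abs_nonneg _)
  rw [Real.dist_eq, sub_zero, abs_of_nonneg hge]
  linarith

/-! ## §2 The existence target implies King's per-string socket -/

section Scheme

variable {G : Type*} [GaugeGroup G] [MeasurableSpace G] [RegularGaugeGroup G] [HaarData G] {O : Type*}

/-- **`HasContinuumLimit S ⇒ KING'S PER-STRING SOCKET`** (radius `1`, volume factor `1`, offset `0`, constants `c_{K,n} = log Z_{K+n}(0) −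
log Z_K(0)`, remainders = the suprema of the direct differences of the generating functions from level `K` on): the scheme's generating
functions are 1-Lipschitz and bounded by `|t|` for EVERY `K` (`T4GenFunBounds.abs_genFun_schemeZ_sub_le` ∕ `abs_genFun_schemeZ_le`, from
`|obs| ≤ 1`) and converge pointwise under the existence target (`T4GenFunConverse.tendsto_genFunLim_of_hasContinuumLimit`), so §1 applies.
Together with `DirectPairingApex.hasContinuumLimit_of_king`: King's socket ⟺ `HasContinuumLimit S` ⟺ `StringwiseGenFunCauchy S`. [folklore] -/
theorem king_of_hasContinuumLimit (S : TorusScheme G O) (hβ : ∀ K, 0 ≤ S.β K)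
    (hm : ∀ K o, Measurable (S.obs K o)) (h1 : ∀ K o U, |S.obs K o U| ≤ 1) (h : HasContinuumLimit S) :
    ∀ os : List O, ∃ (l₀ vol : ℝ) (K₀ : ℕ) (Δ : ℕ → ℝ), 0 < l₀ ∧ Tendsto Δ atTop (𝓝 0) ∧
      ∀ K n : ℕ, ∃ c : ℝ, ∀ t : ℝ, |t| ≤ l₀ →
        |Real.log (T4GenFunBounds.schemeZ S os (K₀ + (K + n)) t) -
            Real.log (T4GenFunBounds.schemeZ S os (K₀ + K) t) - c| ≤ vol * Δ K := by
  intro os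
  obtain ⟨Δ, hΔ, hb⟩ := exists_unifRemainder (G := fun K t => genFun (T4GenFunBounds.schemeZ S os) K t)
    (g := genFunLim (T4GenFunBounds.schemeZ S os)) (l₀ := 1) (L := 1) (B := 1) zero_le_one one_pos
    (fun K s _ t _ => by
      rw [one_mul]
      exact T4GenFunBounds.abs_genFun_schemeZ_sub_le S hβ hm h1 K os s t)
    (fun K t ht => (T4GenFunBounds.abs_genFun_schemeZ_le S hβ hm h1 K os t).trans (abs_le.2 ht))
    (fun t _ => T4GenFunConverse.tendsto_genFunLim_of_hasContinuumLimit S hβ hm h1 h os t)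
  refine ⟨1, 1, 0, Δ, one_pos, hΔ, fun K n => ⟨Real.log (T4GenFunBounds.schemeZ S os (K + n) 0) -
    Real.log (T4GenFunBounds.schemeZ S os K 0), fun t ht => ?_⟩⟩
  have key := hb K n t (abs_le.1 ht)
  rw [zero_add, zero_add, one_mul]
  calc |Real.log (T4GenFunBounds.schemeZ S os (K + n) t) - Real.log (T4GenFunBounds.schemeZ S os K t) -
          (Real.log (T4GenFunBounds.schemeZ S os (K + n) 0) - Real.log (T4GenFunBounds.schemeZ S os K 0))|
      = |genFun (T4GenFunBounds.schemeZ S os) (K + n) t - genFun (T4GenFunBounds.schemeZ S os) K t| := by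
        unfold genFun
        ring_nf
    _ ≤ Δ K := key

/-! ## §3 The equivalences -/

/-- **KING'S PER-STRING SOCKET ⟺ THE EXISTENCE OF THE CONTINUUM LIMIT** (`Missing.HasContinuumLimit S`), for a scheme with `β_K ≥ 0` and
measurable observables bounded by `1` (⇒ `DirectPairingApex.hasContinuumLimit_of_king`; ⇐ `king_of_hasContinuumLimit`). [folklore] -/
theorem king_iff_hasContinuumLimit (S : TorusScheme G O) (hβ : ∀ K, 0 ≤ S.β K)
    (hm : ∀ K o, Measurable (S.obs K o)) (h1 : ∀ K o U, |S.obs K o U| ≤ 1) :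
    (∀ os : List O, ∃ (l₀ vol : ℝ) (K₀ : ℕ) (Δ : ℕ → ℝ), 0 < l₀ ∧ Tendsto Δ atTop (𝓝 0) ∧
      ∀ K n : ℕ, ∃ c : ℝ, ∀ t : ℝ, |t| ≤ l₀ →
        |Real.log (T4GenFunBounds.schemeZ S os (K₀ + (K + n)) t) -
            Real.log (T4GenFunBounds.schemeZ S os (K₀ + K) t) - c| ≤ vol * Δ K) ↔ HasContinuumLimit S :=
  ⟨hasContinuumLimit_of_king S hβ hm h1, king_of_hasContinuumLimit S hβ hm h1⟩

/-- **… ⟺ NODE U6's PER-STRING OUTPUT `StringwiseGenFunCauchy S`** (with the tree's `T4ApexHybrid.stringwise_iff_hasContinuumLimit`). [folklore] -/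
theorem king_iff_stringwiseGenFunCauchy (S : TorusScheme G O) (hβ : ∀ K, 0 ≤ S.β K)
    (hm : ∀ K o, Measurable (S.obs K o)) (h1 : ∀ K o U, |S.obs K o U| ≤ 1) :
    (∀ os : List O, ∃ (l₀ vol : ℝ) (K₀ : ℕ) (Δ : ℕ → ℝ), 0 < l₀ ∧ Tendsto Δ atTop (𝓝 0) ∧
      ∀ K n : ℕ, ∃ c : ℝ, ∀ t : ℝ, |t| ≤ l₀ →
        |Real.log (T4GenFunBounds.schemeZ S os (K₀ + (K + n)) t) -
            Real.log (T4GenFunBounds.schemeZ S os (K₀ + K) t) - c| ≤ vol * Δ K) ↔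
      T4ApexHybrid.StringwiseGenFunCauchy S :=
  (king_iff_hasContinuumLimit S hβ hm h1).trans (T4ApexHybrid.stringwise_iff_hasContinuumLimit S hβ hm h1).symm

end Scheme

section Prefix

variable {F : T4Family} {G : Type*} [GaugeGroup G] [MeasurableSpace G] [RegularGaugeGroup G] [HaarData G]

/-- **UNDER THE PREFIX: KING'S SOCKET ⟺ `StringwiseUnder`** (any β-side hypothesis `Hβ`), for data with measurable averaging maps
(`β_K ≥ 0`, measurability and `|obs| ≤ 1` are the data's own bookkeeping facts). [folklore] -/
theorem kingUnder_iff_stringwiseUnder (D : FiniteEpsData F G) (hM : D.AvgMeasurable) (Hβ : Prop) :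
    (D.UnderHypotheses Hβ fun g₀ =>
      ∀ os : List (ULoop F), ∃ (l₀ vol : ℝ) (K₀ : ℕ) (Δ : ℕ → ℝ), 0 < l₀ ∧ Tendsto Δ atTop (𝓝 0) ∧
        ∀ K n : ℕ, ∃ c : ℝ, ∀ t : ℝ, |t| ≤ l₀ →
          |Real.log (T4GenFunBounds.schemeZ (D.scheme g₀) os (K₀ + (K + n)) t) -
              Real.log (T4GenFunBounds.schemeZ (D.scheme g₀) os (K₀ + K) t) - c| ≤ vol * Δ K) ↔
      T4ApexHybrid.StringwiseUnder D Hβ :=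
  ⟨stringwiseUnder_of_kingUnder D, fun h =>
    FiniteEpsData.UnderHypotheses.mono (fun g₀ hg =>
      (king_iff_stringwiseGenFunCauchy (D.scheme g₀) (fun K => (D.scheme_β_eq g₀ K).2)
        (fun K C => D.measurable_avgObs hM K C) (fun K C U => D.abs_avgObs_le_one K C U)).2 hg) h⟩

/-- **UNDER THE PREFIX: KING'S SOCKET ⟺ THE EXISTENCE TARGET `ym4_torus_continuum_limit_exists`** (β-side hypothesis `BetaPertHyp D.βfun`;
the tree's `T4ApexHybrid.limit_exists_iff_stringwiseUnder`).  So re-wiring the spine's NE9 slot through King's currency (E-side list of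
`NE9.md` §17 → `DirectPairing*` → `DirectPairingApex`) asks EXACTLY the existence target of the apex — nothing more, nothing less. [folklore] -/
theorem kingUnder_iff_limit_exists (D : FiniteEpsData F G) (hM : D.AvgMeasurable) :
    (D.UnderHypotheses (BetaPertHyp D.βfun) fun g₀ =>
      ∀ os : List (ULoop F), ∃ (l₀ vol : ℝ) (K₀ : ℕ) (Δ : ℕ → ℝ), 0 < l₀ ∧ Tendsto Δ atTop (𝓝 0) ∧
        ∀ K n : ℕ, ∃ c : ℝ, ∀ t : ℝ, |t| ≤ l₀ →
          |Real.log (T4GenFunBounds.schemeZ (D.scheme g₀) os (K₀ + (K + n)) t) -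
              Real.log (T4GenFunBounds.schemeZ (D.scheme g₀) os (K₀ + K) t) - c| ≤ vol * Δ K) ↔
      D.ym4_torus_continuum_limit_exists :=
  (kingUnder_iff_stringwiseUnder D hM _).trans (T4ApexHybrid.limit_exists_iff_stringwiseUnder D hM).symm

end Prefix

end Summit.QuantumFields.BalabanUV.T4Continuum.NE9.DirectPairingApexConverse
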